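import Mathlib
import Literature.Analysis.FluidPDE.LocalTypeISliceMorrey
import Literature.Analysis.FluidPDE.AxisDistancePowerIntegral
import Summits.NavierStokesRegularity.NavierStokesRegularity.Theorems.LocalSineTubeDoorProfileAlignedWindowRigidityAncient
import HarnessLib

/-!
# AxisTwistDoor · crux `TiltDominationLoc` (stmt-NavierStokesRegularity-26991) · birth skeleton STUB 1
# `stub_neckLength`, part B — the slice energy of a class profile in a ball of radius `2R` is `≤ A″R`

For a profile of the route's energy class (Type-I rate `C`, continuity on the open lower slab, Albritton–Barker
`𝐈 < ∞`): `∫_{B(x,2R)} |v(s)|² ≤ A″R` for ALL `s < 0`, `R > 0`, `x`, with `A″ = 8C²|B₁| + 4𝐈`: by the Type-I rate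
when `R² ≤ −s` (`lintegral_ball_le_of_typeI_far`), and by Albritton–Barker's `A ≤ 𝐈`
(`Literature…ae_forall_lintegral_ball_le_of_typeIBound_apex`, a.e. in time, upgraded to the given time by Fatou
along the continuity of the profile, `lintegral_ball_le_of_morrey_near`) when `−s < R²`.

Seat ns-el-k1b g0.  WHAT THIS IS NOT: not a statement about Navier–Stokes regularity; an elementary energy bound
for HYPOTHETICAL Type-I blow-up profiles. [cite: AlbrittonBarker2019, §1 (the quantities A and 𝐈)]
-/

noncomputable section

-- the summit and its single sub-problem share the name (CONVENTIONS §1), as in every Theorems file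
set_option linter.dupNamespace false

namespace Summit.NavierStokesRegularity.NavierStokesRegularity.Theorems.TiltDominationLoc.SliceEnergy

open scoped Topology InnerProductSpace NNReal ENNReal
open Set Function MeasureTheory Filter Metric
open Literature.Analysis Literature.Analysis.FluidPDE
open Summit.NavierStokesRegularity.NavierStokesRegularity.Theorems.LocalSineTubeDoorProfileAlignedWindowRigidityAncient
  (continuous_slice bdd_of_hasTypeITimeDecay)

/-! ### step (3): the slice energy of a class profile in a ball of radius `2R` is `≤ A″ R` -/

/-- **Far regime (`R² ≤ −s`)**: the Type-I rate alone gives `∫_{B(x,2R)} |v(s)|² ≤ 8C²R·|B₁|`. -/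
theorem lintegral_ball_le_of_typeI_far {C : ℝ} {v : ℝ → EuclideanSpace ℝ (Fin 3) → EuclideanSpace ℝ (Fin 3)}
    (hrate : HasTypeITimeDecay C v) {s : ℝ} (hs : s < 0) {R : ℝ} (hR : 0 < R) (hRs : R ^ 2 ≤ -s)
    (x : EuclideanSpace ℝ (Fin 3)) :
    ∫⁻ y in ball x (2 * R), ‖v s y‖ₑ ^ 2 ≤
      ENNReal.ofReal (8 * C ^ 2 * R) * volume (ball (0 : EuclideanSpace ℝ (Fin 3)) 1) := by
  have hms : 0 < -s := neg_pos.2 hs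
  have hpt : ∀ y, ‖v s y‖ₑ ^ 2 ≤ ENNReal.ofReal (C ^ 2 / (-s)) := by
    intro y
    have h1 := hrate s hs y
    have hC : 0 ≤ C / Real.sqrt (-s) := (norm_nonneg _).trans h1
    rw [← ofReal_norm, ← ENNReal.ofReal_pow (norm_nonneg _)]
    refine ENNReal.ofReal_le_ofReal ?_
    calc ‖v s y‖ ^ 2 ≤ (C / Real.sqrt (-s)) ^ 2 := pow_le_pow_left₀ (norm_nonneg _) h1 2
      _ = C ^ 2 / (-s) := by rw [div_pow, Real.sq_sqrt hms.le]
  calc ∫⁻ y in ball x (2 * R), ‖v s y‖ₑ ^ 2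
      ≤ ∫⁻ _ in ball x (2 * R), ENNReal.ofReal (C ^ 2 / (-s)) := lintegral_mono fun y => hpt y
    _ = ENNReal.ofReal (C ^ 2 / (-s)) * volume (ball x (2 * R)) := setLIntegral_const _ _
    _ = ENNReal.ofReal (C ^ 2 / (-s)) * (ENNReal.ofReal ((2 * R) ^ 3) * volume (ball (0 : EuclideanSpace ℝ (Fin 3)) 1)) := by
        rw [Measure.addHaar_ball_of_pos volume x (by positivity : 0 < 2 * R), finrank_euclideanSpace_fin]
    _ = ENNReal.ofReal (C ^ 2 / (-s) * (2 * R) ^ 3) * volume (ball (0 : EuclideanSpace ℝ (Fin 3)) 1) := by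
        rw [← mul_assoc, ← ENNReal.ofReal_mul (by positivity)]
    _ ≤ ENNReal.ofReal (8 * C ^ 2 * R) * volume (ball (0 : EuclideanSpace ℝ (Fin 3)) 1) := by
        -- `R³/(−s) ≤ R` since `R² ≤ −s`
        refine mul_le_mul' (ENNReal.ofReal_le_ofReal ?_) le_rfl
        have e : C ^ 2 / (-s) * (2 * R) ^ 3 = 8 * C ^ 2 * R * (R ^ 2 / (-s)) := by
          field_simp
          ring
        have h1 : R ^ 2 / (-s) ≤ 1 := (div_le_one hms).2 hRs
        rw [e]
        have h2 : 0 ≤ 8 * C ^ 2 * R := by positivity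
        nlinarith

/-- The apex parabolic cylinders lie in the lower half space. -/
theorem parabolicCylinder_apex_subset (a : ℝ) :
    FluidPDE.parabolicCylinder a (0 : ℝ × EuclideanSpace ℝ (Fin 3)) ⊆ Iio (0 : ℝ) ×ˢ univ := by
  intro w hw
  rw [FluidPDE.mem_parabolicCylinder] at hw
  exact ⟨by simpa using hw.1.2, mem_univ _⟩

/-- **Near regime (`−s < 16R²`)**: Albritton–Barker's `A ≤ 𝐈` on the slice (a.e. in time by
`…ae_forall_lintegral_ball_le_of_typeIBound_apex`, then at the given time by Fatou along the continuity of the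
profile): `∫_{B(x,2R)} |v(s)|² ≤ 4R · 𝐈`. -/
theorem lintegral_ball_le_of_morrey_near {v : ℝ → EuclideanSpace ℝ (Fin 3) → EuclideanSpace ℝ (Fin 3)}
    {π : ℝ → EuclideanSpace ℝ (Fin 3) → ℝ}
    {H : ℝ → EuclideanSpace ℝ (Fin 3) → EuclideanSpace ℝ (Fin 3) →L[ℝ] EuclideanSpace ℝ (Fin 3)}
    (hcont : ContinuousOn (uncurry v) (Iio (0 : ℝ) ×ˢ univ))
    {s : ℝ} (hs : s < 0) {R : ℝ} (hR : 0 < R) (hRs : -s < 16 * R ^ 2) (x : EuclideanSpace ℝ (Fin 3)) :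
    ∫⁻ y in ball x (2 * R), ‖v s y‖ₑ ^ 2 ≤
      ENNReal.ofReal (2 * (2 * R)) * typeIBound (Iio (0 : ℝ) ×ˢ univ) v π H := by
  set M : ℝ≥0∞ := typeIBound (Iio (0 : ℝ) ×ˢ univ) v π H with hM
  have hIa : ∀ a : ℝ, 0 < a → typeIBound (FluidPDE.parabolicCylinder a (0 : ℝ × EuclideanSpace ℝ (Fin 3))) v π H ≤ M :=
    fun a _ => typeIBound_mono (parabolicCylinder_apex_subset a)
  have hae := ae_forall_lintegral_ball_le_of_typeIBound_apex hIa (ρ := 2 * R) (by positivity)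
  -- the window `S` of good times around `s`
  set S : Set ℝ := Ioo (-(2 * (2 * R)) ^ 2) 0 with hS
  have hsS : s ∈ S := by
    refine ⟨?_, hs⟩
    nlinarith
  obtain ⟨δ, hδ, hδS⟩ : ∃ δ : ℝ, 0 < δ ∧ Ioo (s - δ) (s + δ) ⊆ S := by
    refine ⟨min (s - (-(2 * (2 * R)) ^ 2)) (-s), lt_min (by linarith [hsS.1]) (neg_pos.2 hs), fun t ht => ⟨?_, ?_⟩⟩
    · have := min_le_left (s - (-(2 * (2 * R)) ^ 2)) (-s)
      linarith [ht.1]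
    · have := min_le_right (s - (-(2 * (2 * R)) ^ 2)) (-s)
      linarith [ht.2]
  -- a sequence of good times `t n → s`
  have hex : ∀ n : ℕ, ∃ t : ℝ, t ∈ Ioo (s - δ * ((n : ℝ) + 1)⁻¹) (s + δ * ((n : ℝ) + 1)⁻¹) ∧ t < 0 ∧
      ∀ z : EuclideanSpace ℝ (Fin 3), ∫⁻ y in ball z (2 * R), ‖v t y‖ₑ ^ 2 ≤ ENNReal.ofReal (2 * (2 * R)) * M := by
    intro n
    have hn1 : (1 : ℝ) ≤ (n : ℝ) + 1 := by
      have : (0 : ℝ) ≤ n := Nat.cast_nonneg n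
      linarith
    have hδn : 0 < δ * ((n : ℝ) + 1)⁻¹ := by positivity
    have hδle : δ * ((n : ℝ) + 1)⁻¹ ≤ δ := by
      have : ((n : ℝ) + 1)⁻¹ ≤ 1 := inv_le_one_of_one_le₀ hn1
      nlinarith
    set Sn : Set ℝ := Ioo (s - δ * ((n : ℝ) + 1)⁻¹) (s + δ * ((n : ℝ) + 1)⁻¹) with hSn
    have hsub : Sn ⊆ S := by
      refine Subset.trans ?_ hδS
      intro t ht
      exact ⟨by linarith [ht.1], by linarith [ht.2]⟩
    have hae' : ∀ᵐ t ∂(volume.restrict Sn), (t ∈ Sn) ∧ ∀ z : EuclideanSpace ℝ (Fin 3),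
        ∫⁻ y in ball z (2 * R), ‖v t y‖ₑ ^ 2 ≤ ENNReal.ofReal (2 * (2 * R)) * M :=
      (ae_restrict_mem measurableSet_Ioo).and (ae_restrict_of_ae_restrict_of_subset hsub hae)
    have hne : (ae (volume.restrict Sn)).NeBot := by
      rw [ae_restrict_neBot, hSn, Real.volume_Ioo]
      have : 0 < s + δ * ((n : ℝ) + 1)⁻¹ - (s - δ * ((n : ℝ) + 1)⁻¹) := by linarith
      exact (ENNReal.ofReal_pos.2 this).ne'
    obtain ⟨t, htSn, ht⟩ := hae'.exists
    exact ⟨t, htSn, (hsub htSn).2, ht⟩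
  choose t ht using hex
  have htends : Tendsto t atTop (𝓝 s) := by
    have h1 : Tendsto (fun n : ℕ => ((n : ℝ) + 1)⁻¹) atTop (𝓝 0) :=
      tendsto_one_div_add_atTop_nhds_zero_nat.congr fun n => by ring
    have hδn : Tendsto (fun n : ℕ => δ * ((n : ℝ) + 1)⁻¹) atTop (𝓝 0) := by
      simpa using h1.const_mul δ
    have hlo : Tendsto (fun n : ℕ => s - δ * ((n : ℝ) + 1)⁻¹) atTop (𝓝 s) := by
      simpa using hδn.const_sub s
    have hhi : Tendsto (fun n : ℕ => s + δ * ((n : ℝ) + 1)⁻¹) atTop (𝓝 s) := by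
      simpa using hδn.const_add s
    exact tendsto_of_tendsto_of_tendsto_of_le_of_le hlo hhi (fun n => (ht n).1.1.le) (fun n => (ht n).1.2.le)
  -- Fatou at the time `s`
  have hlim : ∀ y : EuclideanSpace ℝ (Fin 3), Tendsto (fun n => ‖v (t n) y‖ₑ ^ 2) atTop (𝓝 (‖v s y‖ₑ ^ 2)) := by
    intro y
    have hc : ContinuousAt (uncurry v) (s, y) :=
      hcont.continuousAt ((isOpen_Iio.prod isOpen_univ).mem_nhds ⟨hs, mem_univ _⟩)
    have h2 : Tendsto (fun n => ((t n, y) : ℝ × EuclideanSpace ℝ (Fin 3))) atTop (𝓝 (s, y)) :=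
      htends.prodMk_nhds tendsto_const_nhds
    have h3 : Tendsto (fun n => v (t n) y) atTop (𝓝 (v s y)) := hc.tendsto.comp h2
    exact ((ENNReal.continuous_pow 2).tendsto _).comp h3.enorm
  have hmeas : ∀ n, Measurable fun y : EuclideanSpace ℝ (Fin 3) => ‖v (t n) y‖ₑ ^ 2 :=
    fun n => (continuous_slice hcont (ht n).2.1).measurable.enorm.pow_const 2
  calc ∫⁻ y in ball x (2 * R), ‖v s y‖ₑ ^ 2
      = ∫⁻ y in ball x (2 * R), liminf (fun n => ‖v (t n) y‖ₑ ^ 2) atTop :=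
        lintegral_congr fun y => ((hlim y).liminf_eq).symm
    _ ≤ liminf (fun n => ∫⁻ y in ball x (2 * R), ‖v (t n) y‖ₑ ^ 2) atTop := lintegral_liminf_le hmeas
    _ ≤ liminf (fun _ : ℕ => ENNReal.ofReal (2 * (2 * R)) * M) atTop :=
        liminf_le_liminf (Eventually.of_forall fun n => (ht n).2.2 x)
    _ = ENNReal.ofReal (2 * (2 * R)) * M := liminf_const _

/-- **Step (3): a uniform slice-energy bound for the class.**  For a profile of the route's energy class there is
`A″ ≥ 0` with `∫_{B(x,2R)} |v(s)|² ≤ A″R` for all `s < 0`, `R > 0`, `x` (far regime by the Type-I rate, near regime by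
`A ≤ 𝐈`). -/
theorem exists_sliceEnergy_bound {C : ℝ} {v : ℝ → EuclideanSpace ℝ (Fin 3) → EuclideanSpace ℝ (Fin 3)}
    {π : ℝ → EuclideanSpace ℝ (Fin 3) → ℝ}
    {H : ℝ → EuclideanSpace ℝ (Fin 3) → EuclideanSpace ℝ (Fin 3) →L[ℝ] EuclideanSpace ℝ (Fin 3)}
    (hrate : HasTypeITimeDecay C v) (hcont : ContinuousOn (uncurry v) (Iio (0 : ℝ) ×ˢ univ))
    (hI : typeIBound (Iio (0 : ℝ) ×ˢ univ) v π H < ⊤) :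
    ∃ A'' : ℝ, 0 ≤ A'' ∧ ∀ s : ℝ, s < 0 → ∀ R : ℝ, 0 < R → ∀ x : EuclideanSpace ℝ (Fin 3),
      ∫⁻ y in ball x (2 * R), ‖v s y‖ₑ ^ 2 ≤ ENNReal.ofReal (A'' * R) := by
  set M : ℝ≥0∞ := typeIBound (Iio (0 : ℝ) ×ˢ univ) v π H with hM
  set V₁ : ℝ := (volume (ball (0 : EuclideanSpace ℝ (Fin 3)) 1)).toReal with hV₁
  have hV₁0 : 0 ≤ V₁ := ENNReal.toReal_nonneg
  have hMtop : M ≠ ⊤ := hI.ne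
  refine ⟨8 * C ^ 2 * V₁ + 4 * M.toReal, by positivity, fun s hs R hR x => ?_⟩
  rcases le_or_gt (R ^ 2) (-s) with hfar | hnear
  · calc ∫⁻ y in ball x (2 * R), ‖v s y‖ₑ ^ 2
        ≤ ENNReal.ofReal (8 * C ^ 2 * R) * volume (ball (0 : EuclideanSpace ℝ (Fin 3)) 1) :=
          lintegral_ball_le_of_typeI_far hrate hs hR hfar x
      _ = ENNReal.ofReal (8 * C ^ 2 * R * V₁) := by
          rw [hV₁, ENNReal.ofReal_mul (by positivity : (0 : ℝ) ≤ 8 * C ^ 2 * R),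
            ENNReal.ofReal_toReal measure_ball_lt_top.ne]
      _ ≤ ENNReal.ofReal ((8 * C ^ 2 * V₁ + 4 * M.toReal) * R) := by
          refine ENNReal.ofReal_le_ofReal ?_
          nlinarith [ENNReal.toReal_nonneg (a := M), sq_nonneg C]
  · have hnear' : -s < 16 * R ^ 2 := by nlinarith
    calc ∫⁻ y in ball x (2 * R), ‖v s y‖ₑ ^ 2
        ≤ ENNReal.ofReal (2 * (2 * R)) * M := lintegral_ball_le_of_morrey_near (π := π) (H := H) hcont hs hR hnear' x
      _ = ENNReal.ofReal (4 * M.toReal * R) := by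
          rw [show 4 * M.toReal * R = (2 * (2 * R)) * M.toReal by ring,
            ENNReal.ofReal_mul (by positivity : (0 : ℝ) ≤ 2 * (2 * R)), ENNReal.ofReal_toReal hMtop]
      _ ≤ ENNReal.ofReal ((8 * C ^ 2 * V₁ + 4 * M.toReal) * R) := by
          refine ENNReal.ofReal_le_ofReal ?_
          nlinarith [sq_nonneg C, mul_nonneg (mul_nonneg (by norm_num : (0:ℝ) ≤ 8) (sq_nonneg C)) hV₁0]

end Summit.NavierStokesRegularity.NavierStokesRegularity.Theorems.TiltDominationLoc.SliceEnergy

end
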